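import Mathlib
import HarnessLib

/-!
# `kernel_eq_span_of_modular_certificate` (crux `OddMorawetzLocal`, line `registered`, refutation)

Stub `stub_kernel_eq_span` of the refutation skeleton of the crux
`Summit.NavierStokesRegularity.NavierStokesRegularity.Theses.OddMorawetz.OddMorawetzLocal`
(item `stmt-NavierStokesRegularity-1376`): abstract linear algebra; Mathlib only; no named facts.

Statement. Let `A : Matrix ι κ ℤ`, `p` a prime, and suppose
* an `r × r` submatrix of `A` (rows `I`, columns `J`) has a right inverse `B` mod `p`;
* `d` integer vectors `S l` lie in the kernel of `A`, and the `d × d` matrix `(S l (K l'))` has a right inverse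
  `C` mod `p`;
* `r + d = Fintype.card κ`.
Then every real solution `c` of `A c = 0` is a real linear combination of the vectors `S l`.

Proof. Determinants commute with ring homomorphisms (`Int.cast_det`), so an integer square matrix whose
reduction mod `p` has a right inverse has nonzero integer determinant, hence its real image has unit determinant
(`isUnit_det_map_real_of_mul_eq_one_zmod`). Applied to the `r × r` block this gives
`r = rank (A_ℝ.submatrix I J) ≤ rank A_ℝ` (`Matrix.rank_of_isUnit`, `Matrix.rank_submatrix_le`), so by rank–nullity
(`LinearMap.finrank_range_add_finrank_ker`) the real kernel of `A_ℝ` has dimension `≤ d`. Applied to the `d × d`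
block it gives linear independence of the real vectors `S l` (a vanishing combination restricted to the
coordinates `K l'` is a vector `g` with `g ᵥ* M_ℝ = 0`, `Matrix.eq_zero_of_vecMul_eq_zero`). The `S l` lie in the
kernel (`RingHom.map_mulVec`), span a `d`-dimensional subspace of it (`finrank_span_eq_card`), hence all of it
(`Submodule.eq_of_le_of_finrank_le`), and membership in the span is the required combination
(`Submodule.mem_span_range_iff_exists_fun`).

No definitions, no named facts; everything proved from Mathlib.
-/

noncomputable section

-- single-conjunct summit: `Summit.<Summit>.<Problem>` repeats the name by the D-0017 layout
set_option linter.dupNamespace false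

namespace Summit.NavierStokesRegularity.NavierStokesRegularity.Theorems

open Matrix Module

/-- If the reduction mod a prime `p` of an integer square matrix `M` has a right inverse `N`, then the
determinant of the real image of `M` is a unit: `det` commutes with `ℤ → ZMod p` and `ℤ → ℝ` (`Int.cast_det`),
the first image is a unit hence nonzero, so `det M ≠ 0` in `ℤ` and in `ℝ`. -/
theorem isUnit_det_map_real_of_mul_eq_one_zmod {n : Type*} [Fintype n] [DecidableEq n] (p : ℕ)
    [Fact p.Prime] (M : Matrix n n ℤ) (N : Matrix n n (ZMod p))
    (h : M.map (Int.cast : ℤ → ZMod p) * N = 1) :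
    IsUnit (M.map (Int.cast : ℤ → ℝ)).det := by
  -- the determinant mod `p` is a unit
  have hp : IsUnit (M.map (Int.cast : ℤ → ZMod p)).det := by
    have hdet := congrArg Matrix.det h
    rw [Matrix.det_mul, Matrix.det_one] at hdet
    exact IsUnit.of_mul_eq_one _ hdet
  -- hence the integer determinant is nonzero
  have hZ : M.det ≠ 0 := by
    intro h0
    have h1 : (M.map (Int.cast : ℤ → ZMod p)).det = 0 := by
      rw [← Int.cast_det, h0, Int.cast_zero]
    rw [h1] at hp
    exact not_isUnit_zero hp
  rw [isUnit_iff_ne_zero, ← Int.cast_det]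
  exact Int.cast_ne_zero.mpr hZ

/-- **Modular rank certificate pins a real kernel to an explicit span.** For an integer matrix `A`, if an
`r × r` submatrix (rows `I`, columns `J`) is invertible mod a prime `p`, and `d` integer vectors `S l` lie in the
kernel of `A` and have a `d × d` coordinate submatrix (columns `K`) invertible mod `p`, with `r + d` the number of
columns, then every real vector `c` with `A c = 0` is a real linear combination of the `S l`
(rank `≥ r` from the unit `r × r` block and `Matrix.rank_submatrix_le`; rank–nullity; linear independence of the
`S l` from the unit `d × d` block; `d` independent kernel vectors span a kernel of dimension `≤ d`). -/
theorem kernel_eq_span_of_modular_certificate {ι κ : Type*} [Fintype ι] [Fintype κ] [DecidableEq ι] [DecidableEq κ]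
    (p : ℕ) [Fact p.Prime] (A : Matrix ι κ ℤ) {r d : ℕ}
    (I : Fin r → ι) (J : Fin r → κ) (B : Matrix (Fin r) (Fin r) (ZMod p))
    (hB : ((A.submatrix I J).map (Int.cast : ℤ → ZMod p)) * B = 1)
    (S : Fin d → κ → ℤ) (hS : ∀ l, A.mulVec (S l) = 0)
    (K : Fin d → κ) (C : Matrix (Fin d) (Fin d) (ZMod p))
    (hC : (Matrix.of fun l l' => ((S l (K l') : ℤ) : ZMod p)) * C = 1)
    (hcard : r + d = Fintype.card κ) :
    ∀ c : κ → ℝ, (A.map (Int.cast : ℤ → ℝ)).mulVec c = 0 →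
      ∃ γ : Fin d → ℝ, c = ∑ l, γ l • (fun j => ((S l j : ℤ) : ℝ)) := by
  intro c hc
  set Aℝ : Matrix ι κ ℝ := A.map (Int.cast : ℤ → ℝ) with hAℝ
  set Sℝ : Fin d → κ → ℝ := fun l j => ((S l j : ℤ) : ℝ) with hSℝ
  -- Step 1: the unit `r × r` block gives `r ≤ rank Aℝ`
  have h1 : r ≤ Aℝ.rank := by
    have hU : IsUnit (Aℝ.submatrix I J) := by
      rw [Matrix.isUnit_iff_isUnit_det]
      exact isUnit_det_map_real_of_mul_eq_one_zmod p (A.submatrix I J) B hB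
    have hle := Matrix.rank_submatrix_le Aℝ I J
    rwa [Matrix.rank_of_isUnit _ hU, Fintype.card_fin] at hle
  -- Step 2: rank–nullity gives `finrank (ker Aℝ) ≤ d`
  have h2 : finrank ℝ (LinearMap.ker Aℝ.mulVecLin) ≤ d := by
    have hrn := LinearMap.finrank_range_add_finrank_ker Aℝ.mulVecLin
    rw [Module.finrank_fintype_fun_eq_card] at hrn
    have hr : Aℝ.rank = finrank ℝ (LinearMap.range Aℝ.mulVecLin) := rfl
    omega
  -- Step 3: the real vectors `Sℝ l` lie in the kernel ...
  have h3 : ∀ l, Sℝ l ∈ LinearMap.ker Aℝ.mulVecLin := by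
    intro l
    rw [LinearMap.mem_ker, Matrix.mulVecLin_apply]
    funext i
    have hi := RingHom.map_mulVec (Int.castRingHom ℝ) A (S l) i
    rw [hS l, Pi.zero_apply, map_zero] at hi
    rw [Pi.zero_apply, hi]
    rfl
  -- ... and are linearly independent, by the unit `d × d` block
  have h4 : LinearIndependent ℝ Sℝ := by
    rw [Fintype.linearIndependent_iff]
    intro g hg
    have hM : IsUnit ((Matrix.of fun l l' => (S l (K l') : ℤ)).map (Int.cast : ℤ → ℝ)).det :=
      isUnit_det_map_real_of_mul_eq_one_zmod p (Matrix.of fun l l' => (S l (K l') : ℤ)) C hC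
    have hv : g ᵥ* ((Matrix.of fun l l' => (S l (K l') : ℤ)).map (Int.cast : ℤ → ℝ)) = 0 := by
      funext l'
      have hl' := congrFun hg (K l')
      simp only [Finset.sum_apply, Pi.smul_apply, smul_eq_mul, Pi.zero_apply] at hl'
      simpa [Matrix.vecMul, dotProduct] using hl'
    have h0 := Matrix.eq_zero_of_vecMul_eq_zero hM.ne_zero hv
    exact fun l => congrFun h0 l
  -- Step 4: `d` independent kernel vectors span the kernel (dimension `≤ d`)
  have h5 : Submodule.span ℝ (Set.range Sℝ) = LinearMap.ker Aℝ.mulVecLin := by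
    apply Submodule.eq_of_le_of_finrank_le
    · exact Submodule.span_le.mpr (Set.range_subset_iff.mpr h3)
    · rw [finrank_span_eq_card h4, Fintype.card_fin]
      exact h2
  have hc' : c ∈ Submodule.span ℝ (Set.range Sℝ) := by
    rw [h5, LinearMap.mem_ker, Matrix.mulVecLin_apply]
    exact hc
  obtain ⟨γ, hγ⟩ := (Submodule.mem_span_range_iff_exists_fun ℝ).mp hc'
  exact ⟨γ, hγ.symm⟩

end Summit.NavierStokesRegularity.NavierStokesRegularity.Theorems

end
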